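import Literature.AlgebraicGeometry.AbelianSchemes.AbelianSchemeStructureOnLift
import Literature.AlgebraicGeometry.AbelianSchemes.AbelianLiftObstructionClass
import Literature.AlgebraicGeometry.AbelianSchemes.ArtinLocalFibreProjectiveCover
import Literature.AlgebraicGeometry.Deformation.SmoothLiftAtlasAssemblyQuot
import Literature.AlgebraicGeometry.Deformation.SmoothLiftClosedFibreDictionaryQuot
import Literature.AlgebraicGeometry.Deformation.SmoothLiftOfClassZeroAtlasQuot
import Literature.AlgebraicGeometry.Morphisms.ProperOfSurjectiveComp
import HarnessLib

/-!
# An abelian scheme over `A ⧸ J` lifts to an abelian scheme over the Artin local ring `A` as soon as its underlying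
# SCHEME lifts smoothly — the (U)-free tail of [Oort1971] Thm. (2.2.1) ∕ [MumfordFogartyKirwan1994] Prop. 6.15 — QUOTIENT CURRENCY

Layer `Literature/AlgebraicGeometry/AbelianSchemes`, namespace `Literature.AlgebraicGeometry.AbelianSchemes.AbelianSchemeOver`.
PROOF FILE, THEOREMS ONLY (no definition, no instance, no notation, no named fact, no `sorry`).  Cell `hodgecm-mathlib`, P6
sub-desk P6b, FINAL CONSUMER board 19:49:42Z: **FC-2** «abelian specialisation» (A-p12 (g31); count-neutral ★ capital on
`--supports stmt-HodgeConjecture-24832`); consumer of record = the BANKED `Cruxes/HLiu418/Lines/F0_P6b_BTSerreTate.lean` §1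
`stub_L4B1u_abelianLiftOfIsUnitTwo` (conclusion letters token for token).

THE PRINT.  [Oort1971, Thm. (2.2.1), p. 273 and first proof pp. 279–280]: an abelian scheme `X₀ → Spec (A⧸J)` lifts to `Spec A`
as soon as the obstruction `D(X′; A → A⧸J) ∈ H²(X_k, Θ) ⊗_k J` to lifting the underlying smooth SCHEME vanishes; «then the
identity section and the group law lift» — [MumfordFogartyKirwan1994, Ch. 6 §3 Prop. 6.15, p. 124 and proof p. 125]: `A` Artin
local, `𝔪·J = 0`, `X → Spec A` smooth PROPER whose base change to `A⧸J` is an abelian scheme ⇒ `X` is an abelian scheme.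

* §1 **`exists_abelianLift_of_smoothLift`** — THE (U)-FREE TAIL, in FC-1's OUTPUT LETTERS: `A` Artin local, `J ≠ ⊤`, `𝔪·J = 0`
  (any such `J` — no principality here), `X₀` an abelian scheme over `Spec (A⧸J)` of relative dimension `g`, and a SMOOTH lift of its
  underlying scheme in the shape FC-1 (`Deformation/SmoothLiftOfCocycleAtlasQuot` ∘ `…CocycleAtlasOfClassZeroQuot`) returns —
  `∃ (X' : Scheme) (q : X' ⟶ Spec A) (Φ₀ : X₀ ⟶ X'), Smooth q ∧ Φ₀ ≫ q = f₀ ≫ Spec (mk J) ∧ IsPullback Φ₀ f₀ q (Spec (mk J))` at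
  `f₀ := X₀.X.hom` — ⇒ an abelian scheme `X` over `Spec A` of relative dimension `g` with `G : X₀ → X` a base change of GROUP schemes
  (★ `IsBaseChangeVia`).  Proof: `q` is proper (★ `Morphisms/ProperOfSurjectiveComp.isProper_of_isPullback_specMap_quotientMk_of_ne_top`:
  `Φ₀` is a base change of the surjective closed immersion `Spec (A⧸J) ↪ Spec A`), then ★ `AbelianSchemeStructureOnLift.
  exists_abelianSchemeOver_of_isPullback` (= ★ `exists_mul_lift_of_isPullback_specMap_mk` ∘ ★ (A4)
  `exists_abelianSchemeOver_of_isPullback_of_liftLaw`).  This is also the tail FC-3's length induction re-enters at every step.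
* §2 (ED. 2, typed the minute FC-1a's binder block is boxed) **`exists_abelianLift_of_classZero`** — FC-2 PROPER: `J` PRINCIPAL small
  (`φ : ↥J ≃ₗ[A] IsLocalRing.ResidueField A`), and ONE Prop-binder `hvan` = «for every normalised liftable atlas of `X₀.X`
  (★ (ζ) `exists_atlas`'s ∃-block as ∀-binders: `n V c P r ψ` + cover ∕ equations ∕ onto ∕ kernels ∕ compatibility),
  for the CANONICAL closed fibre `X_κ := X₀ ×_{A⧸J} κ(A)` (★ `AbelianSchemeOver.baseChange`, an abelian variety over `κ(A)` — desk ruling (β′):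
  the (U-ab) discharger gets its group law and `[-1]` for free) over `X₀` by `i := pr₁`, a closed-fibre layer `π` pinned to `i^♯` (★ (vii-b)
  `LiftObstructionClassAtlasQuot`'s `(i hiV 𝔪 h𝔪J hJ𝔪 π hπ hπnat)` letters at `𝔪 := 𝔪_A`), all face readings `δ` (`readingAut … δ = disc …`,
  ★ (ii)) and every Čech 2-cochain `o` of `𝒯_{X_κ/κ}` on `i⁻¹V` representing them, closed: `CechMH2.mk … ⟨o, ho₂⟩ = 0`» — the (U-ab) CONTRACT,
  later discharged from `IsUnit (2 : A)` ([Oort1971] p. 279: the class is canonical, `[-1]^*` acts on it by `−1`) — ⇒ the same conclusion; proof =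
  closed fibre `X₀ ×_{A⧸J} κ` projective (★ `isProjective_baseChange_hom_of_field`) ⇒ principal affine cover (★
  `exists_principal_affine_cover_of_isProjective`) lifted along the nilpotent thickening (★ `exists_principal_affine_cover_lift`,
  ★ `isNilpotent_ker_of_isPullback_specMap`) → ★ (ζ) `exists_atlas` (`CompactSpace` ⟸ proper over `Spec`) → FC-1 (FC-1a with `hvan`
  instantiated, then FC-1b) → §1.

HC_CM is proved only modulo the printed citations until rung 0 closes; nothing here bears on a summit statement.

## References
* [Oort1971] F. Oort, *Finite group schemes, local moduli for abelian varieties, and lifting problems*, Compositio Math. 23 (1971),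
  Theorem (2.2.1) (p. 273) and its first proof (pp. 279–280).
* [MumfordFogartyKirwan1994] D. Mumford, J. Fogarty, F. Kirwan, *Geometric Invariant Theory*, 3rd ed. (1994), Ch. 6 §3 Prop. 6.15
  (p. 124) and its proof (p. 125).
* [EGAII] A. Grothendieck, *Éléments de géométrie algébrique II*, Publ. Math. IHÉS 8 (1961), Cor. 5.4.6.
-/

noncomputable section

set_option backward.isDefEq.respectTransparency false

open CategoryTheory CategoryTheory.Limits AlgebraicGeometry TopologicalSpace Opposite
open scoped TensorProduct
open Literature.AlgebraicGeometry.Morphisms Literature.AlgebraicGeometry.HodgeTheory Literature.AlgebraicGeometry.Modules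
  Literature.AlgebraicGeometry.Motives
open Literature.AlgebraicGeometry.Deformation.AtlasQuot Literature.AlgebraicGeometry.Deformation.CanonicalLiftQuot
  Literature.AlgebraicGeometry.Deformation.LiftAtlasAssemblyQuot Literature.AlgebraicGeometry.Deformation.LiftableCoverQuot
  Literature.AlgebraicGeometry.Deformation.LiftObstructionCocycleQuot Literature.AlgebraicGeometry.Deformation.ExtensionAutomorphismsQuot
  Literature.AlgebraicGeometry.Deformation.LiftObstructionCechClassQuot Literature.AlgebraicGeometry.Deformation.LiftObstructionClassAtlasQuot
  Literature.AlgebraicGeometry.Deformation.LiftClosedFibreDictionaryQuot Literature.AlgebraicGeometry.Deformation.LiftOfClassZeroAtlasQuot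

universe u

namespace Literature.AlgebraicGeometry.AbelianSchemes.AbelianSchemeOver

/-! ## §1 The (U)-free tail: a smooth lift of the underlying scheme of an abelian scheme is an abelian lift -/

variable {A : Type} [CommRing A] [IsArtinianRing A] [IsLocalRing A] {J : Ideal A}

/-- **FC-2, the (U)-free tail ([MumfordFogartyKirwan1994] Prop. 6.15 read on FC-1's output).**  `A` Artin local, `J ≠ ⊤`, `𝔪·J = 0`;
`X₀` an abelian scheme over `Spec (A⧸J)` of relative dimension `g`; a smooth `q : X' → Spec A` and `Φ₀ : X₀ → X'` cartesian over
`Spec (A⧸J) ↪ Spec A` (FC-1's conclusion, letters verbatim at `f₀ := X₀.X.hom`) ⇒ an abelian scheme `X` of relative dimension `g` over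
`Spec A` and `G : X₀ → X` exhibiting `X₀` as its base change as a GROUP scheme (★ `IsBaseChangeVia`) — the conclusion of the banked
`stub_L4B1u_abelianLiftOfIsUnitTwo` token for token.  `q` is proper by ★ `isProper_of_isPullback_specMap_quotientMk_of_ne_top`; the group
law lifts by ★ `exists_abelianSchemeOver_of_isPullback`.
[cite: MumfordFogartyKirwan1994, Ch. 6 §3 Proposition 6.15 (p. 124), proof (p. 125)] [cite: Oort1971, Theorem (2.2.1) (p. 273)]
[cite: EGAII, Cor. 5.4.6] -/
theorem exists_abelianLift_of_smoothLift (hJ : J ≠ ⊤) (hmJ : IsLocalRing.maximalIdeal A * J = ⊥)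
    (X₀ : AbelianSchemeOver (Spec (.of (A ⧸ J)))) {g : ℕ} (hg : X₀.IsOfRelDim g)
    (hlift : ∃ (X' : Scheme.{0}) (q : X' ⟶ Spec (.of A)) (Φ₀ : X₀.X.left ⟶ X'),
      Smooth q ∧ Φ₀ ≫ q = X₀.X.hom ≫ Spec.map (CommRingCat.ofHom (Ideal.Quotient.mk J)) ∧
        IsPullback Φ₀ X₀.X.hom q (Spec.map (CommRingCat.ofHom (Ideal.Quotient.mk J)))) :
    ∃ (X : AbelianSchemeOver (Spec (.of A))) (_ : X.IsOfRelDim g) (G : X₀.X.left ⟶ X.X.left),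
      X₀.IsBaseChangeVia X (Spec.map (CommRingCat.ofHom (Ideal.Quotient.mk J))) G := by
  obtain ⟨X', q, Φ₀, hq, -, hΦ⟩ := hlift
  -- properness of the smooth lift: `Φ₀` is a base change of the surjective closed immersion `Spec (A⧸J) ↪ Spec A`
  haveI : Smooth q := hq
  haveI : IsProper q := by
    haveI := X₀.isProper
    exact Morphisms.isProper_of_isPullback_specMap_quotientMk_of_ne_top hJ hΦ
  haveI hP : IsProper (Over.mk q : Over (Spec (.of A))).hom := ‹IsProper q›
  haveI hS : Smooth (Over.mk q : Over (Spec (.of A))).hom := hq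
  -- [MFK94] Prop. 6.15: the group law lifts, with the relative dimension
  obtain ⟨GX, hgc, hdim, hbc⟩ := exists_abelianSchemeOver_of_isPullback (X := Over.mk q) hJ hmJ hΦ hg
  exact ⟨_, hdim, Φ₀, hbc⟩

/-! ## §2 FC-2 proper: principal small `J`, the (U-ab) contract `hvan`, and the abelian lift -/

/-! ### §2a A finite principal affine cover of an abelian scheme over an Artin local ring (quotient currency) -/

/-- **The closed fibre of an abelian scheme over a local ring is projective** (quotient currency: any field-valued point `s`):
`X₀ ×_R Spec K → Spec K` is an abelian variety over `K`, hence projective. [cite: GortzWedhorn2023, Prop. 27.174 (p. 669)] -/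
theorem isProjective_baseChange_hom_field {R : Type u} [CommRing R] (X₀ : AbelianSchemeOver (Spec (.of R)))
    {K : Type u} [Field K] (s : Spec (.of K) ⟶ Spec (.of R)) :
    Morphisms.IsProjective (X₀.baseChange s).X.hom :=
  Morphisms.IsProjective.of_isProjectiveOver (AbelianVariety.isProjectiveOver_holds (X₀.fibre s).toAbelianVariety)

/-- **A finite principal affine cover of an abelian scheme along a nilpotent thickening of a field point of the base** (quotient
currency — no coefficient field): for `ρ : R ↠ K` onto a field with NILPOTENT kernel, lift a principal affine cover of the projective fibre
`X₀ ×_R K` along the nilpotent thickening `X₀ ×_R K ↪ X₀`. [cite: Hartshorne2010, Thm. 10.2 (proof), p. 81] [cite: StacksProject, Tag 06AD]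
[cite: Hartshorne1977, II Prop. 2.5 (b) and proof (pp. 76–77)] -/
theorem exists_principal_affine_cover_of_surjective_field {R K : Type u} [CommRing R] [Field K] (ρ : R →+* K)
    (hρ : Function.Surjective ρ) (hnil : IsNilpotent (RingHom.ker ρ)) (X₀ : AbelianSchemeOver (Spec (.of R))) :
    ∃ (ι : Type u) (_ : Finite ι) (U : ι → X₀.X.left.affineOpens) (b : (j l : ι) → Γ(X₀.X.left, (U j).1)),
      (⨆ j, (U j).1 = ⊤) ∧ ∀ j l, (U j).1 ⊓ (U l).1 = X₀.X.left.basicOpen (b j l) := by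
  -- the fibre `X := X₀ ×_R K` and `i := pr₁`
  let s : Spec (.of K) ⟶ Spec (.of R) := Spec.map (CommRingCat.ofHom ρ)
  let i : (X₀.baseChange s).X.left ⟶ X₀.X.left := pullback.fst X₀.X.hom s
  have hsq : IsPullback i (X₀.baseChange s).X.hom X₀.X.hom s := IsPullback.of_hasPullback X₀.X.hom s
  -- a finite principal affine cover of the projective `K`-scheme `X`
  obtain ⟨ι, hι, U, b, hcov, hb⟩ := Morphisms.exists_principal_affine_cover_of_isProjective (isProjective_baseChange_hom_field X₀ s)
  -- `i` is a closed immersion with nilpotent kernel ideal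
  haveI : IsClosedImmersion i := MorphismProperty.of_isPullback hsq.flip (IsClosedImmersion.spec_of_surjective _ hρ)
  have hnil' : IsNilpotent i.ker := Morphisms.isNilpotent_ker_of_isPullback_specMap ρ hρ hnil hsq
  -- lift the cover along the nilpotent thickening `i`; the lift covers
  obtain ⟨U', b', hU', hb'⟩ := Morphisms.exists_principal_affine_cover_lift i hnil' U b hb
  refine ⟨ι, hι, U', b', Morphisms.preimage_injective_of_isNilpotent_ker i hnil' ?_, hb'⟩
  rw [Scheme.Hom.preimage_iSup, Scheme.Hom.preimage_top]
  simp_rw [hU']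
  exact hcov

/-- **A finite principal affine cover of an abelian scheme over an Artin local ring** (the residue map `R ↠ κ(R)` has nilpotent kernel).
[cite: Hartshorne2010, Thm. 10.2 (proof), p. 81] [cite: StacksProject, Tag 06AD] -/
theorem exists_principal_affine_cover_of_isArtinianRing {R : Type u} [CommRing R] [IsArtinianRing R] [IsLocalRing R]
    (X₀ : AbelianSchemeOver (Spec (.of R))) :
    ∃ (ι : Type u) (_ : Finite ι) (U : ι → X₀.X.left.affineOpens) (b : (j l : ι) → Γ(X₀.X.left, (U j).1)),
      (⨆ j, (U j).1 = ⊤) ∧ ∀ j l, (U j).1 ⊓ (U l).1 = X₀.X.left.basicOpen (b j l) := by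
  refine exists_principal_affine_cover_of_surjective_field (IsLocalRing.residue R) IsLocalRing.residue_surjective ?_ X₀
  rw [IsLocalRing.ker_residue, ← IsLocalRing.jacobson_eq_maximalIdeal ⊥ bot_ne_top]
  exact IsArtinianRing.isNilpotent_jacobson_bot

/-! ### §2b The head -/

/-- **FC-2 ([Oort1971] Thm. (2.2.1) modulo the (U-ab) contract).**  `A` Artin local, `J` a PRINCIPAL small ideal (`J ≠ ⊤`, `𝔪·J = 0`,
`φ : J ≅ κ(A)`), `X₀` an abelian scheme over `Spec (A⧸J)` of relative dimension `g`.  HYPOTHESIS `hvan : LiftObstructionVanishes hJ hmJ φ X₀` (★ `AbelianLiftObstructionClass`, the (U-ab)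
contract as ONE predicate, in ★ (vii-b) `LiftObstructionClassAtlasQuot`'s letters): for every lifted atlas of `X₀` (finite principal affine cover `V`, equations `c`, standard smooth
flat charts `r a : P a ↠ Γ(X₀, V a)` with `ker = J·P a`, reduction-compatible gluings `ψ` — ★ (ζ) `exists_atlas`'s output, sections `A`-algebras through
`X₀ → Spec (A⧸J)`), for the CANONICAL closed fibre `X_κ := X₀ ×_{A⧸J} κ(A)` (an abelian variety over `κ(A)`, ★ `AbelianSchemeOver.baseChange`) lying
over `X₀` by `i := pr₁`, its sections `A`-algebras through `κ(A)` (`halgκ`), a closed-fibre layer `π` PINNED to `i^♯` (`hπi`; `hiV hπ hπnat` its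
affineness ∕ exactness ∕ naturality), all face readings `δ_{abd}` of the atlas (`readingAut … δ = disc …`, ★ (ii)) and every Čech 2-cochain `o` of
`𝒯_{X_κ/κ}` on the trace cover `i⁻¹V` representing them (`ho`) and closed (`ho₂`): ITS CLASS VANISHES, `[o] = 0 ∈ Ȟ²(i⁻¹𝒰; 𝒯_{X_κ/κ})`.  CONCLUSION: an
abelian scheme `X` over `Spec A` of relative dimension `g` with `G : X₀ → X` a base change of group schemes — the banked `stub_L4B1u` letters.
Road: §2a cover → ★ (ζ) `exists_atlas` → FC-1a (`hvan` instantiated; `hiV hπ hπnat` by the (vii-c) dictionary) → FC-1b → §1.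
[cite: Oort1971, Theorem (2.2.1) (p. 273) and pp. 277–280] [cite: MumfordFogartyKirwan1994, Ch. 6 §3 Proposition 6.15 (p. 124), proof (p. 125)]
[cite: Hartshorne2010, Thm. 10.2 (a) (proof), p. 81] -/
theorem exists_abelianLift_of_classZero {A : Type} [CommRing A] [IsArtinianRing A] [IsLocalRing A] {J : Ideal A}
    (hJ : J ≠ ⊤) (hmJ : IsLocalRing.maximalIdeal A * J = ⊥) (φ : ↥J ≃ₗ[A] IsLocalRing.ResidueField A)
    (X₀ : AbelianSchemeOver (Spec (.of (A ⧸ J)))) {g : ℕ} (hg : X₀.IsOfRelDim g)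
    (hvan : LiftObstructionVanishes hJ hmJ φ X₀) :
    ∃ (X : AbelianSchemeOver (Spec (.of A))) (_ : X.IsOfRelDim g) (G : X₀.X.left ⟶ X.X.left),
      X₀.IsBaseChangeVia X (Spec.map (CommRingCat.ofHom (Ideal.Quotient.mk J))) G := by
  -- the section rings of `X₀` as `A`-algebras through `X₀ → Spec (A⧸J) → Spec A` ((ζ)'s `letI`)
  letI instΓ₀ : ∀ W : X₀.X.left.Opens, Algebra A Γ(X₀.X.left, W) := fun W =>
    (((Scheme.ΓSpecIso (.of (A ⧸ J))).inv ≫ X₀.X.hom.appLE ⊤ W le_top).hom.comp (Ideal.Quotient.mk J)).toAlgebra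
  have halg₀ := halg_of_structureMorphism (A' := A) X₀.X.hom
  have hstr : ∀ (W : X₀.X.left.Opens) (x : A), algebraMap A Γ(X₀.X.left, W) x =
      ((Scheme.ΓSpecIso (.of (A ⧸ J))).inv ≫ X₀.X.hom.appLE ⊤ W le_top) (Ideal.Quotient.mk J x) := fun W x => rfl
  have halg₀' : ∀ (W : X₀.X.left.Opens) (a : A), algebraMap A Γ(X₀.X.left, W) a =
      (X₀.X.hom.appLE ⊤ W le_top) ((Scheme.ΓSpecIso (.of (A ⧸ J))).inv (Ideal.Quotient.mk J a)) := fun W a => rfl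
  have hJnil : IsNilpotent J := LiftedLaw.isNilpotent_of_ne_top hJ
  haveI : Smooth X₀.X.hom := X₀.isSmooth
  haveI : CompactSpace X₀.X.left := by
    haveI := X₀.isProper
    exact QuasiCompact.compactSpace_of_compactSpace X₀.X.hom
  -- the residue model `ρ : A ⧸ J ↠ κ(A)` (kernel `𝔪_A (A⧸J)`, nilpotent)
  let ρ : A ⧸ J →+* IsLocalRing.ResidueField A := Ideal.Quotient.factor (IsLocalRing.le_maximalIdeal hJ)
  have hκ : Function.Surjective (algebraMap A (IsLocalRing.ResidueField A)) := IsLocalRing.residue_surjective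
  have hφfac : ∀ a : A, ρ (Ideal.Quotient.mk J a) = algebraMap A (IsLocalRing.ResidueField A) a := fun a => rfl
  have h𝔪 : RingHom.ker (algebraMap A (IsLocalRing.ResidueField A)) = IsLocalRing.maximalIdeal A :=
    IsLocalRing.ker_residue
  have hρ : Function.Surjective ρ := Ideal.Quotient.factor_surjective _
  have hρnil : IsNilpotent (RingHom.ker ρ) := by
    rw [← map_mk_ker_eq_ker J ρ hφfac, h𝔪]
    obtain ⟨k, hk⟩ := LiftedLaw.isNilpotent_of_ne_top (IsLocalRing.maximalIdeal.isMaximal A).ne_top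
    exact ⟨k, by rw [← Ideal.map_pow, hk, Ideal.zero_eq_bot, Ideal.map_bot, Ideal.zero_eq_bot]⟩
  -- §2a: a finite principal affine cover of `X₀`; ★ (ζ): the lifted atlas with STANDARD SMOOTH charts
  obtain ⟨ι₀, _, U, b, hU, hb⟩ := exists_principal_affine_cover_of_surjective_field ρ hρ hρnil X₀
  obtain ⟨n, V, c, τ, P, _, _, _, r, ψ, hV, hc, -, hr, hkr, hψ, -, -⟩ :=
    exists_atlas (A' := A) hJnil X₀.X.hom U b hb hU
  -- the canonical closed fibre `X_κ := X₀ ×_{A⧸J} κ(A)`, its sections as `A`-algebras through `κ(A)`, and the ★ (vii-c) dictionary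
  letI instΓκ : ∀ W : (closedFibre hJ X₀).X.left.Opens, Algebra A Γ((closedFibre hJ X₀).X.left, W) := fun W =>
    (((constToPresheaf (closedFibre hJ X₀).X).app (op W)).hom.comp (algebraMap A (IsLocalRing.ResidueField A))).toAlgebra
  have halgκ : ∀ (W : (closedFibre hJ X₀).X.left.Opens) (a : A), algebraMap A Γ((closedFibre hJ X₀).X.left, W) a =
      (constToPresheaf (closedFibre hJ X₀).X).app (op W) (algebraMap A (IsLocalRing.ResidueField A) a) := fun W a => rfl
  have H : IsPullback (closedFibreι hJ X₀) (closedFibre hJ X₀).X.hom X₀.X.hom (residueBaseMap hJ) :=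
    IsPullback.of_hasPullback X₀.X.hom (residueBaseMap hJ)
  obtain ⟨hiV, π, hπi, hπ, hπnat⟩ := exists_closedFibreMaps_atlas hκ J ρ hφfac X₀.X.hom
    (closedFibreι hJ X₀) H halg₀' halgκ (IsLocalRing.maximalIdeal A) h𝔪 V
  -- the face readings of the atlas (★ (c1) `existsUnique_reading_discrepancy` on the canonical reductions)
  have hδex : ∀ a b d : Fin n, ∃ δ : Derivation A Γ((closedFibre hJ X₀).X.left, closedFibreι hJ X₀ ⁻¹ᵁ ((V a).1 ⊓ (V b).1 ⊓ (V d).1))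
      (Γ((closedFibre hJ X₀).X.left, closedFibreι hJ X₀ ⁻¹ᵁ ((V a).1 ⊓ (V b).1 ⊓ (V d).1)) ⊗[A] ↥J),
      readingAut halg₀ hJnil V r hr hkr (IsLocalRing.maximalIdeal A) π hπ hmJ (IsLocalRing.le_maximalIdeal hJ) a
        (inf_le_left.trans inf_le_left : (V a).1 ⊓ (V b).1 ⊓ (V d).1 ≤ (V a).1) ⟨_, inf₃_eq_basicOpen₁ V c hc a b d⟩ δ =
      disc halg₀ hJnil V c hc r hr hkr ψ hψ a b d := fun a b d => by
    have ha' : (V a).1 ⊓ (V b).1 ⊓ (V d).1 ≤ (V a).1 := inf_le_left.trans inf_le_left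
    have hb' : (V a).1 ⊓ (V b).1 ⊓ (V d).1 ≤ (V b).1 := inf_le_left.trans inf_le_right
    have hd' : (V a).1 ⊓ (V b).1 ⊓ (V d).1 ≤ (V d).1 := inf_le_right
    have pa : ∃ q : Γ(X₀.X.left, (V a).1), (V a).1 ⊓ (V b).1 ⊓ (V d).1 = X₀.X.left.basicOpen q := ⟨_, inf₃_eq_basicOpen₁ V c hc a b d⟩
    have pb : ∃ q : Γ(X₀.X.left, (V b).1), (V a).1 ⊓ (V b).1 ⊓ (V d).1 = X₀.X.left.basicOpen q := ⟨_, inf₃_eq_basicOpen₂ V c hc a b d⟩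
    have pd : ∃ q : Γ(X₀.X.left, (V d).1), (V a).1 ⊓ (V b).1 ⊓ (V d).1 = X₀.X.left.basicOpen q := ⟨_, inf₃_eq_basicOpen₃ V c hc a b d⟩
    haveI := Deformation.CanonicalLiftQuot.flat (r a) (Deformation.AtlasQuot.res ha')
    -- ★ (c1): the discrepancy of the three restricted gluings lies over the identity, hence has a (unique) reading
    obtain ⟨ε, hε, -⟩ := existsUnique_reading_discrepancy (IsLocalRing.maximalIdeal A) J hmJ (IsLocalRing.le_maximalIdeal hJ)
      (fibreRed halg₀ V r π a ha') (fibreRed_surjective halg₀ hJnil V r hr hkr (IsLocalRing.maximalIdeal A) π hπ a ha' pa)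
      (ker_fibreRed halg₀ hJnil V r hr hkr (IsLocalRing.maximalIdeal A) π hπ (IsLocalRing.le_maximalIdeal hJ) a ha' pa)
      (reduction (r a) (Deformation.AtlasQuot.res ha') (halg₀ _ _ _)) (reduction (r b) (Deformation.AtlasQuot.res hb') (halg₀ _ _ _))
      (reduction (r d) (Deformation.AtlasQuot.res hd') (halg₀ _ _ _))
      (ker_reduction hJnil (r a) (hr a) (hkr a) (Deformation.AtlasQuot.res ha') (halg₀ _ _ _)
        ((V a).2.isLocalization_of_eq_basicOpen _ (homOfLE ha') (inf₃_eq_basicOpen₁ V c hc a b d)))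
      (gluingOn halg₀ hJnil V r hr hkr ψ hψ a b _ ha' hb' pa pb) (gluingOn halg₀ hJnil V r hr hkr ψ hψ b d _ hb' hd' pb pd)
      (gluingOn halg₀ hJnil V r hr hkr ψ hψ a d _ ha' hd' pa pd)
      (reduction_gluingOn halg₀ hJnil V r hr hkr ψ hψ a b _ ha' hb' pa pb) (reduction_gluingOn halg₀ hJnil V r hr hkr ψ hψ b d _ hb' hd' pb pd)
      (reduction_gluingOn halg₀ hJnil V r hr hkr ψ hψ a d _ ha' hd' pa pd)
    exact ⟨ε, hε⟩
  choose δ hδ using hδex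
  -- the Čech 2-cochain of the readings on the trace cover, a cocycle (★ (vii), ★ (vii-b))
  obtain ⟨o, ho⟩ := exists_cochain_rep hκ halgκ J φ
    (fun a => (⟨closedFibreι hJ X₀ ⁻¹ᵁ (V a).1, hiV a⟩ : (closedFibre hJ X₀).X.left.affineOpens))
    (fun a b => (closedFibreι hJ X₀).app (V a).1 (c a b)) (preimage_inf_eq_basicOpen V c hc (closedFibreι hJ X₀) hiV) δ
  have ho₂ : o ∈ cechMZ2 (closedFibre hJ X₀).X.hom (tangentSheaf (closedFibre hJ X₀).X) (fun a => closedFibreι hJ X₀ ⁻¹ᵁ (V a).1) :=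
    (mem_cechMZ2_iff _ _ _ o).2 (cechMD2_eq_zero_of_atlas hκ halgκ J φ halg₀ hJnil V c hc r hr hkr (closedFibreι hJ X₀) hiV
      (IsLocalRing.maximalIdeal A) hmJ (IsLocalRing.le_maximalIdeal hJ) π hπ hπnat ψ hψ δ hδ ho)
  -- THE (U-ab) CONTRACT: the class vanishes
  have h0 := hvan n V c P r ψ hV hc hr hkr hψ π hπ δ hδ halgκ hπi hiV hπnat o ho ho₂
  -- ★ FC-1: a smooth lift with closed fibre `X₀`; §1: it is an abelian lift
  obtain ⟨X', q, Φ₀, -, hq, hw, hpb, -⟩ := exists_smooth_lift_of_cechMH2_mk_eq_zero hκ halgκ J φ halg₀ hJnil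
    V c hc r hr hkr (closedFibreι hJ X₀) hiV (IsLocalRing.maximalIdeal A) hmJ (IsLocalRing.le_maximalIdeal hJ) π hπ X₀.X.hom hstr hV
    hπnat ψ hψ δ hδ ho ho₂ h0
  exact exists_abelianLift_of_smoothLift hJ hmJ X₀ hg ⟨X', q, Φ₀, hq, hw, hpb⟩

end Literature.AlgebraicGeometry.AbelianSchemes.AbelianSchemeOver

end
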